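import Mathlib
import HarnessLib
import Summits.CriticalPhenomena.PercolationContinuityZ3.Theses.PercTreeValue
import Summits.CriticalPhenomena.PercolationContinuityZ3.Theorems.PercTreeValueTetrahedronHarrisGapStubCondHarris
import Summits.CriticalPhenomena.PercolationContinuityZ3.Theorems.PercTreeValueTetrahedronHarrisGapStubCap
import Summits.CriticalPhenomena.PercolationContinuityZ3.Theorems.PercTreeValueTetrahedronHarrisGapStubCovSlicing
import Literature.Probability.Percolation.BlockResampling
import Literature.Probability.Percolation.InfiniteClusterDensity
import Literature.Probability.Percolation.TwoPointFunction
import Literature.Probability.Percolation.CriticalContinuityProofs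

/-!
# The corner-ball reduction of crux `TetrahedronHarrisGap` (stmt-CriticalPhenomena-7799) to its three open inputs

Line `SketchIdeator1` (card `corner-ball-total-covariance`; skeleton `Cruxes/TetrahedronHarrisGap/Lines/SketchIdeator1.lean`).
This file LANDS the registered sub-goal `crux_of_open_stubs` of the crux item: the crux
`Summit.CriticalPhenomena.PercolationContinuityZ3.Theses.PercTreeValue.TetrahedronHarrisGap` follows from the three OPEN
stub statements alone —

* gluing-lite `stub_G` (`τ(0,a_r), τ(b_r,c_r) ≥ c₀ · P(boxArm (r/8+1) 0)²`, pointwise hyperscaling-lite),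
* blocking `stub_block` (`P(f_r = 0), P(g_r = 0) ≥ c_B`; a corollary of `PercAnnulusCrossing.CritAnnulusNonCrossing`, stmt-0846),
* the relative gap `stub_fatGap` (Cov ≥ δ'·P·P for the level sets of the bulk hook probabilities at two-sided-fat levels),

because the three PROVABLE stubs are theorems of the tree: `stub_condHarris` (conditional Harris inside the block,
`…StubCondHarris.lean`), `stub_cap` (hook cap `f_r, g_r ≤ π_r²`, `…StubCap.lean`), `stub_covSlicing` (covariance slicing,
`…StubCovSlicing.lean`). Here `f_r = blockCondProb (zdGraph 3) p_c K_r (openConn 0 a_r)` etc. are the tree's written-out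
conditional probabilities given the configuration off the corner block `K_r` (BlockResampling.lean).

Contents: `CornerBall.blockCondProb_mono`, `CornerBall.isUpperSet_lt_blockCondProb` (level sets of `P(E | ω off B)` are
increasing events), `CornerBall.integral_le_add_mul_measureReal_le` (Markov on a window),
`CornerBall.mul_sub_le_setIntegral_levelSet` (window integral of a fat level function), `line_composition` (the six stub
statements verbatim ⟹ crux: total covariance `Cov(A,B) ≥ ∫fg − ∫f∫g ≥ δ'(∫_W P(f>s))(∫_W P(g>t)) ≥ (δ'c₀⁴/256) ττ` on the
window `W = [c₀π²/8, c₀π²/4]`), and `crux_of_open_stubs` (the registered let-form). No new definitions; sorry-free; the open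
inputs are HYPOTHESES (the theorem is a reduction, not a proof of the crux).
-/

noncomputable section

open MeasureTheory Filter Set
open Literature.Probability.Percolation Literature.Probability.LatticeModels

namespace Summit.CriticalPhenomena.PercolationContinuityZ3.Theorems.TetrahedronHarrisGap

namespace CornerBall
variable {V : Type*} (G : SimpleGraph V) (p : unitInterval)

/-- `P_p(E | ω off B)` is increasing in `ω` when `E` is an increasing event. -/
theorem blockCondProb_mono (B : Finset (Sym2 V)) {E : Set (BondConfig V)} (hE : IsUpperSet E) :
    Monotone (blockCondProb G p B E) := by
  intro ω ω' hle
  unfold blockCondProb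
  refine Finset.sum_le_sum fun ξ _ => ?_
  refine mul_le_mul_of_nonneg_left ?_ measureReal_nonneg
  have hsub : ω \ (↑B : Set (Sym2 V)) ∪ ↑ξ ≤ ω' \ ↑B ∪ ↑ξ :=
    Set.union_subset_union_left _ (Set.sdiff_subset_sdiff_left hle)
  by_cases h : ω \ (↑B : Set (Sym2 V)) ∪ ↑ξ ∈ E
  · rw [Set.indicator_of_mem h, Set.indicator_of_mem (hE hsub h)]
    simp only [Pi.one_apply, le_refl]
  · rw [Set.indicator_of_notMem h]
    exact Set.indicator_nonneg (fun _ _ => zero_le_one) _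

/-- Level sets of `P_p(E | ω off B)` are increasing events (for `E` increasing). -/
theorem isUpperSet_lt_blockCondProb (B : Finset (Sym2 V)) {E : Set (BondConfig V)} (hE : IsUpperSet E)
    (s : ℝ) : IsUpperSet {ω : BondConfig V | s < blockCondProb G p B E ω} :=
  fun _ _ hle h => lt_of_lt_of_le h (blockCondProb_mono G p B hE hle)

/-- **Markov on the window.** If `0 ≤ f ≤ M` almost everywhere then
`∫ f ≤ w + M · P(w ≤ f)` for every `w ≥ 0`. -/
theorem integral_le_add_mul_measureReal_le {Ω : Type*} [MeasurableSpace Ω] (μ : Measure Ω)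
    [IsProbabilityMeasure μ] {f : Ω → ℝ} (hfm : Measurable f) (hfi : Integrable f μ) {M w : ℝ}
    (hw : 0 ≤ w) (hM : ∀ᵐ ω ∂μ, f ω ≤ M) :
    ∫ ω, f ω ∂μ ≤ w + M * μ.real {ω | w ≤ f ω} := by
  have hmeas : MeasurableSet {ω | w ≤ f ω} := measurableSet_le measurable_const hfm
  have hpt : ∀ᵐ ω ∂μ, f ω ≤ w + M * {ω | w ≤ f ω}.indicator (fun _ => (1 : ℝ)) ω := by
    filter_upwards [hM] with ω hωM
    by_cases h : w ≤ f ω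
    · rw [Set.indicator_of_mem (show ω ∈ {ω | w ≤ f ω} from h), mul_one]
      linarith
    · rw [Set.indicator_of_notMem (show ω ∉ {ω | w ≤ f ω} from h), mul_zero, add_zero]
      exact le_of_lt (not_le.1 h)
  have hind : Integrable (fun ω => {ω | w ≤ f ω}.indicator (fun _ => (1 : ℝ)) ω) μ :=
    (integrable_const (1 : ℝ)).indicator hmeas
  have hint : Integrable (fun ω => w + M * {ω | w ≤ f ω}.indicator (fun _ => (1 : ℝ)) ω) μ :=
    (integrable_const w).add (hind.const_mul M)
  calc ∫ ω, f ω ∂μ ≤ ∫ ω, (w + M * {ω | w ≤ f ω}.indicator (fun _ => (1 : ℝ)) ω) ∂μ :=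
        integral_mono_ae hfi hint hpt
    _ = w + M * μ.real {ω | w ≤ f ω} := by
        rw [integral_add (integrable_const w) (hind.const_mul M), integral_const_mul,
          integral_indicator_const _ hmeas, integral_const, probReal_univ, one_smul, smul_eq_mul, mul_one]

/-- **The window integral of a fat level function.** If `c ≤ P(s < f)` for all `s ≤ v` then
`c (v - u) ≤ ∫_{[u,v]} P(s < f) ds` (`u ≤ v`). -/
theorem mul_sub_le_setIntegral_levelSet {Ω : Type*} [MeasurableSpace Ω] (μ : Measure Ω)
    [IsProbabilityMeasure μ] (f : Ω → ℝ) {c u v : ℝ} (huv : u ≤ v)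
    (hc : ∀ s, s ≤ v → c ≤ μ.real {ω | s < f ω}) :
    c * (v - u) ≤ ∫ s in Set.Icc u v, μ.real {ω | s < f ω} := by
  have hanti : Antitone fun s : ℝ => μ.real {ω | s < f ω} := by
    intro s s' hss'
    exact measureReal_mono (fun ω (h : s' < f ω) => lt_of_le_of_lt hss' h)
  have hmeasf : Measurable fun s : ℝ => μ.real {ω | s < f ω} := hanti.measurable
  have hvol : volume (Set.Icc u v) < ⊤ := measure_Icc_lt_top
  have hint : IntegrableOn (fun s : ℝ => μ.real {ω | s < f ω}) (Set.Icc u v) volume :=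
    IntegrableOn.of_bound hvol hmeasf.aestronglyMeasurable 1
      (ae_of_all _ fun s => by
        rw [Real.norm_eq_abs, abs_of_nonneg measureReal_nonneg]; exact measureReal_le_one)
  have hconst : IntegrableOn (fun _ : ℝ => c) (Set.Icc u v) volume := integrableOn_const hvol.ne
  calc c * (v - u) = ∫ _ in Set.Icc u v, c := by
        rw [setIntegral_const, Real.volume_real_Icc_of_le huv, smul_eq_mul, mul_comm]
    _ ≤ ∫ s in Set.Icc u v, μ.real {ω | s < f ω} :=
        setIntegral_mono_on hconst hint measurableSet_Icc fun s hs => hc s hs.2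

end CornerBall

open CornerBall

/-- **crux_of_open_stubs** (registered sub-goal of stmt-CriticalPhenomena-7799; the durable reduction of line
`SketchIdeator1`). The crux `TetrahedronHarrisGap` follows from its three OPEN inputs — gluing-lite (`stub_G`), blocking
(`stub_block`, a corollary of `PercAnnulusCrossing.CritAnnulusNonCrossing`, stmt-0846) and the relative gap for fat level
sets (`stub_fatGap`) — with the corner block `K` and the bulk hook probabilities `f`, `g` `let`-bound (definitionally the
registered stub texts). Proof = total-covariance bookkeeping: `Cov(A,B) ≥ ∫fg − ∫f∫g` (`stub_condHarris` + tower property),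
`≥ δ'(∫_W P(f>s))(∫_W P(g>t))` (`stub_covSlicing` on the window `W = [c₀π²/8, c₀π²/4]`, whose levels are `min(c₀/2,c_B)`-fat
by `stub_cap` + G + Markov and by block), `≥ δ'(c₀²π²/16)² ≥ (δ'c₀⁴/256)·τ(0,a_r)τ(b_r,c_r)` (`τ ≤ π²` by the cap). -/
theorem crux_of_open_stubs :
    (∃ c₀ : ℝ, 0 < c₀ ∧ ∃ r₀ : ℕ, ∀ r : ℕ, r₀ ≤ r →
      c₀ * (bondPercolation (zdGraph 3) (criticalProbI 3)).real (boxArm (r / 8 + 1) (0 : Site 3)) ^ 2 ≤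
          tau 3 (criticalProbI 3) 0 ![(r : ℤ), (r : ℤ), 0] ∧
        c₀ * (bondPercolation (zdGraph 3) (criticalProbI 3)).real (boxArm (r / 8 + 1) (0 : Site 3)) ^ 2 ≤
          tau 3 (criticalProbI 3) ![(r : ℤ), 0, (r : ℤ)] ![0, (r : ℤ), (r : ℤ)]) →
    (∃ c_B : ℝ, 0 < c_B ∧ ∃ r₀ : ℕ, ∀ r : ℕ, r₀ ≤ r →
      let K : Finset (Sym2 (Site 3)) :=
        armEdges (r / 8) (0 : Site 3) ∪ armEdges (r / 8) ![(r : ℤ), (r : ℤ), 0] ∪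
          armEdges (r / 8) ![(r : ℤ), 0, (r : ℤ)] ∪ armEdges (r / 8) ![0, (r : ℤ), (r : ℤ)];
      let f : BondConfig (Site 3) → ℝ :=
        blockCondProb (zdGraph 3) (criticalProbI 3) K (openConn (0 : Site 3) ![(r : ℤ), (r : ℤ), 0]);
      let g : BondConfig (Site 3) → ℝ :=
        blockCondProb (zdGraph 3) (criticalProbI 3) K (openConn ![(r : ℤ), 0, (r : ℤ)] ![0, (r : ℤ), (r : ℤ)]);
      c_B ≤ (bondPercolation (zdGraph 3) (criticalProbI 3)).real {ω | f ω = 0} ∧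
        c_B ≤ (bondPercolation (zdGraph 3) (criticalProbI 3)).real {ω | g ω = 0}) →
    (∀ κ : ℝ, 0 < κ → ∃ δ' : ℝ, 0 < δ' ∧ ∃ r₀ : ℕ, ∀ r : ℕ, r₀ ≤ r →
      let K : Finset (Sym2 (Site 3)) :=
        armEdges (r / 8) (0 : Site 3) ∪ armEdges (r / 8) ![(r : ℤ), (r : ℤ), 0] ∪
          armEdges (r / 8) ![(r : ℤ), 0, (r : ℤ)] ∪ armEdges (r / 8) ![0, (r : ℤ), (r : ℤ)];
      let f : BondConfig (Site 3) → ℝ :=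
        blockCondProb (zdGraph 3) (criticalProbI 3) K (openConn (0 : Site 3) ![(r : ℤ), (r : ℤ), 0]);
      let g : BondConfig (Site 3) → ℝ :=
        blockCondProb (zdGraph 3) (criticalProbI 3) K (openConn ![(r : ℤ), 0, (r : ℤ)] ![0, (r : ℤ), (r : ℤ)]);
      ∀ s t : ℝ,
      κ ≤ (bondPercolation (zdGraph 3) (criticalProbI 3)).real {ω | s < f ω} →
      (bondPercolation (zdGraph 3) (criticalProbI 3)).real {ω | s < f ω} ≤ 1 - κ →
      κ ≤ (bondPercolation (zdGraph 3) (criticalProbI 3)).real {ω | t < g ω} →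
      (bondPercolation (zdGraph 3) (criticalProbI 3)).real {ω | t < g ω} ≤ 1 - κ →
      δ' * ((bondPercolation (zdGraph 3) (criticalProbI 3)).real {ω | s < f ω} *
          (bondPercolation (zdGraph 3) (criticalProbI 3)).real {ω | t < g ω}) ≤
        (bondPercolation (zdGraph 3) (criticalProbI 3)).real ({ω | s < f ω} ∩ {ω | t < g ω}) -
          (bondPercolation (zdGraph 3) (criticalProbI 3)).real {ω | s < f ω} *
            (bondPercolation (zdGraph 3) (criticalProbI 3)).real {ω | t < g ω}) →
    Summit.CriticalPhenomena.PercolationContinuityZ3.Theses.PercTreeValue.TetrahedronHarrisGap := by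
  intro hG hBl hFG
  classical
  obtain ⟨c₀, hc₀, r₁, hG⟩ := hG
  obtain ⟨cB, hcB, r₂, hBl⟩ := hBl
  -- the fatness parameter and the relative gap it buys
  have hκ : 0 < min (c₀ / 2) cB := lt_min (by linarith) hcB
  obtain ⟨δ', hδ', r₃, hFG⟩ := hFG (min (c₀ / 2) cB) hκ
  unfold Summit.CriticalPhenomena.PercolationContinuityZ3.Theses.PercTreeValue.TetrahedronHarrisGap
  refine ⟨δ' * c₀ ^ 4 / 256, by positivity, max (max 16 r₁) (max r₂ r₃), fun r hr => ?_⟩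
  have h16 : 16 ≤ r := le_trans (le_trans (le_max_left _ _) (le_max_left _ _)) hr
  have hr₁ : r₁ ≤ r := le_trans (le_trans (le_max_right _ _) (le_max_left _ _)) hr
  have hr₂ : r₂ ≤ r := le_trans (le_trans (le_max_left _ _) (le_max_right _ _)) hr
  have hr₃ : r₃ ≤ r := le_trans (le_trans (le_max_right _ _) (le_max_right _ _)) hr
  -- specialise everything to this `r`
  have hG' := hG r hr₁
  have hBl' := hBl r hr₂
  have hFG' := hFG r hr₃
  have hCap' := stub_cap (criticalProbI 3) r h16
  dsimp only at hBl' hFG'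
  clear hG hBl hFG
  -- names
  set P : Measure (BondConfig (Site 3)) := bondPercolation (zdGraph 3) (criticalProbI 3) with hP
  set K : Finset (Sym2 (Site 3)) :=
    armEdges (r / 8) (0 : Site 3) ∪ armEdges (r / 8) ![(r : ℤ), (r : ℤ), 0] ∪
      armEdges (r / 8) ![(r : ℤ), 0, (r : ℤ)] ∪ armEdges (r / 8) ![0, (r : ℤ), (r : ℤ)] with hK
  set A : Set (BondConfig (Site 3)) := openConn (0 : Site 3) ![(r : ℤ), (r : ℤ), 0] with hA
  set B : Set (BondConfig (Site 3)) := openConn ![(r : ℤ), 0, (r : ℤ)] ![0, (r : ℤ), (r : ℤ)] with hB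
  set f : BondConfig (Site 3) → ℝ := blockCondProb (zdGraph 3) (criticalProbI 3) K A with hf
  set g : BondConfig (Site 3) → ℝ := blockCondProb (zdGraph 3) (criticalProbI 3) K B with hg
  set π2 : ℝ := P.real (boxArm (r / 8 + 1) (0 : Site 3)) ^ 2 with hπ2
  -- basic facts about `A`, `B`, `f`, `g`
  have hAm : MeasurableSet A := measurableSet_openConn_holds _ _
  have hBm : MeasurableSet B := measurableSet_openConn_holds _ _
  have hAu : IsUpperSet A := isUpperSet_openConn _ _
  have hBu : IsUpperSet B := isUpperSet_openConn _ _
  have hfm : Measurable f := measurable_blockCondProb _ _ K hAm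
  have hgm : Measurable g := measurable_blockCondProb _ _ K hBm
  have hf01 : ∀ ω, f ω ∈ Set.Icc (0 : ℝ) 1 := fun ω =>
    ⟨blockCondProb_nonneg _ _ K A ω, blockCondProb_le_one _ _ K A ω⟩
  have hg01 : ∀ ω, g ω ∈ Set.Icc (0 : ℝ) 1 := fun ω =>
    ⟨blockCondProb_nonneg _ _ K B ω, blockCondProb_le_one _ _ K B ω⟩
  have hfi : Integrable f P :=
    integrable_blockCondProb _ _ K hAm
  have hgi : Integrable g P :=
    integrable_blockCondProb _ _ K hBm
  -- the two-point functions are the means of `f`, `g`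
  have hτA : tau 3 (criticalProbI 3) 0 ![(r : ℤ), (r : ℤ), 0] = ∫ ω, f ω ∂P := by
    rw [tau_def, hf, integral_blockCondProb_eq _ _ K hAm]
  have hτB : tau 3 (criticalProbI 3) ![(r : ℤ), 0, (r : ℤ)] ![0, (r : ℤ), (r : ℤ)] = ∫ ω, g ω ∂P := by
    rw [tau_def, hg, integral_blockCondProb_eq _ _ K hBm]
  have hpc : 0 < ((criticalProbI 3 : unitInterval) : ℝ) := by
    rw [coe_criticalProbI]; exact (Grimmett1999_criticalProb_pos_lt_one_holds 3 (by norm_num)).1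
  have hτApos : 0 < tau 3 (criticalProbI 3) 0 ![(r : ℤ), (r : ℤ), 0] :=
    tau_pos zdGraph_preconnected_holds _ hpc _ _
  have hτBpos : 0 < tau 3 (criticalProbI 3) ![(r : ℤ), 0, (r : ℤ)] ![0, (r : ℤ), (r : ℤ)] :=
    tau_pos zdGraph_preconnected_holds _ hpc _ _
  -- a.e. the configuration lives on the lattice, so the cap holds a.e.
  have hae : ∀ᵐ ω ∂P, ω ⊆ (zdGraph 3).edgeSet := by
    rw [hP, bondPercolation]
    exact ProbabilityTheory.setBernoulli_ae_subset
  have hcapf : ∀ᵐ ω ∂P, f ω ≤ π2 := hae.mono fun ω hω => (hCap' ω hω).1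
  have hcapg : ∀ᵐ ω ∂P, g ω ≤ π2 := hae.mono fun ω hω => (hCap' ω hω).2
  -- hence `τ ≤ π2`
  have hτAle : tau 3 (criticalProbI 3) 0 ![(r : ℤ), (r : ℤ), 0] ≤ π2 := by
    rw [hτA]
    calc ∫ ω, f ω ∂P ≤ ∫ _, π2 ∂P := integral_mono_ae hfi (integrable_const _) hcapf
      _ = π2 := by rw [integral_const, probReal_univ, one_smul]
  have hτBle : tau 3 (criticalProbI 3) ![(r : ℤ), 0, (r : ℤ)] ![0, (r : ℤ), (r : ℤ)] ≤ π2 := by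
    rw [hτB]
    calc ∫ ω, g ω ∂P ≤ ∫ _, π2 ∂P := integral_mono_ae hgi (integrable_const _) hcapg
      _ = π2 := by rw [integral_const, probReal_univ, one_smul]
  have hπ2pos : 0 < π2 := lt_of_lt_of_le hτApos hτAle
  have hc₀π2 : c₀ * π2 ≤ 1 := le_trans hG'.1 (tau_le_one _ _ _)
  -- the window `W = [u, v]`, `u = c₀ π2 / 8`, `v = c₀ π2 / 4`, and the Markov level `w = c₀ π2 / 2`
  set u : ℝ := c₀ * π2 / 8 with hu
  set v : ℝ := c₀ * π2 / 4 with hv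
  set w : ℝ := c₀ * π2 / 2 with hw
  have hu0 : 0 < u := by positivity
  have huv : u ≤ v := by rw [hu, hv]; linarith [mul_pos hc₀ hπ2pos]
  have hvw : v < w := by rw [hv, hw]; linarith [mul_pos hc₀ hπ2pos]
  have hv1 : v ≤ 1 := by rw [hv]; linarith
  have hw0 : 0 ≤ w := by positivity
  -- lower fatness: `P(w ≤ f) ≥ c₀/2` by Markov, hence `P(s < f) ≥ c₀/2` for `s ≤ v`
  have hfatf : ∀ s, s ≤ v → c₀ / 2 ≤ P.real {ω | s < f ω} := by
    intro s hs
    have hM := integral_le_add_mul_measureReal_le P hfm hfi hw0 hcapf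
    rw [← hτA] at hM
    have h1 : c₀ * π2 - w ≤ π2 * P.real {ω | w ≤ f ω} := by linarith [hG'.1]
    have h2 : c₀ / 2 * π2 ≤ π2 * P.real {ω | w ≤ f ω} := by rw [hw] at h1; linarith
    have h3 : c₀ / 2 ≤ P.real {ω | w ≤ f ω} := by
      by_contra hlt
      push Not at hlt
      have := mul_lt_mul_of_pos_left hlt hπ2pos
      linarith [mul_comm π2 (c₀ / 2)]
    refine h3.trans (measureReal_mono fun ω (hω : w ≤ f ω) => ?_)
    exact lt_of_lt_of_le (lt_of_le_of_lt hs hvw) hω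
  have hfatg : ∀ t, t ≤ v → c₀ / 2 ≤ P.real {ω | t < g ω} := by
    intro t ht
    have hM := integral_le_add_mul_measureReal_le P hgm hgi hw0 hcapg
    rw [← hτB] at hM
    have h1 : c₀ * π2 - w ≤ π2 * P.real {ω | w ≤ g ω} := by linarith [hG'.2]
    have h2 : c₀ / 2 * π2 ≤ π2 * P.real {ω | w ≤ g ω} := by rw [hw] at h1; linarith
    have h3 : c₀ / 2 ≤ P.real {ω | w ≤ g ω} := by
      by_contra hlt
      push Not at hlt
      have := mul_lt_mul_of_pos_left hlt hπ2pos
      linarith [mul_comm π2 (c₀ / 2)]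
    refine h3.trans (measureReal_mono fun ω (hω : w ≤ g ω) => ?_)
    exact lt_of_lt_of_le (lt_of_le_of_lt ht hvw) hω
  -- upper fatness: for `s > 0`, `{s < f} ⊆ {f = 0}ᶜ`, so `P(s < f) ≤ 1 - c_B`
  have hthinf : ∀ s, 0 < s → P.real {ω | s < f ω} ≤ 1 - cB := by
    intro s hs
    have hmeas0 : MeasurableSet {ω | f ω = 0} := hfm (measurableSet_singleton 0)
    have hsub : {ω | s < f ω} ⊆ {ω | f ω = 0}ᶜ := fun ω (hω : s < f ω) (h0 : f ω = 0) => by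
      rw [h0] at hω; exact absurd hω (not_lt.2 hs.le)
    calc P.real {ω | s < f ω} ≤ P.real {ω | f ω = 0}ᶜ := measureReal_mono hsub
      _ = 1 - P.real {ω | f ω = 0} := probReal_compl_eq_one_sub hmeas0
      _ ≤ 1 - cB := by linarith [hBl'.1]
  have hthing : ∀ t, 0 < t → P.real {ω | t < g ω} ≤ 1 - cB := by
    intro t ht
    have hmeas0 : MeasurableSet {ω | g ω = 0} := hgm (measurableSet_singleton 0)
    have hsub : {ω | t < g ω} ⊆ {ω | g ω = 0}ᶜ := fun ω (hω : t < g ω) (h0 : g ω = 0) => by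
      rw [h0] at hω; exact absurd hω (not_lt.2 ht.le)
    calc P.real {ω | t < g ω} ≤ P.real {ω | g ω = 0}ᶜ := measureReal_mono hsub
      _ = 1 - P.real {ω | g ω = 0} := probReal_compl_eq_one_sub hmeas0
      _ ≤ 1 - cB := by linarith [hBl'.2]
  -- Harris for the level sets (all levels)
  have hHarris : ∀ s t : ℝ, P.real {ω | s < f ω} * P.real {ω | t < g ω} ≤
      P.real ({ω | s < f ω} ∩ {ω | t < g ω}) := fun s t =>
    harris_fkg_holds (zdGraph 3) (criticalProbI 3)
      (isUpperSet_lt_blockCondProb _ _ K hAu s) (isUpperSet_lt_blockCondProb _ _ K hBu t)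
      (measurableSet_lt measurable_const hfm) (measurableSet_lt measurable_const hgm)
  -- the relative gap on the window, from stub_fatGap at fatness `min (c₀/2) c_B`
  have hgap : ∀ s ∈ Set.Icc u v, ∀ t ∈ Set.Icc u v,
      δ' * (P.real {ω | s < f ω} * P.real {ω | t < g ω}) ≤
        P.real ({ω | s < f ω} ∩ {ω | t < g ω}) - P.real {ω | s < f ω} * P.real {ω | t < g ω} := by
    intro s hs t ht
    refine hFG' s t ?_ ?_ ?_ ?_
    · exact (min_le_left _ _).trans (hfatf s hs.2)
    · exact (hthinf s (lt_of_lt_of_le hu0 hs.1)).trans (by linarith [min_le_right (c₀ / 2) cB])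
    · exact (min_le_left _ _).trans (hfatg t ht.2)
    · exact (hthing t (lt_of_lt_of_le hu0 ht.1)).trans (by linarith [min_le_right (c₀ / 2) cB])
  -- covariance slicing
  have hslice := stub_covSlicing P f g hfm hgm hf01 hg01 hHarris δ' u v hu0.le hv1 hgap
  -- conditional Harris: `∫ f g ≤ P(A ∩ B)`
  have hcond := stub_condHarris (criticalProbI 3) K A B hAu hBu hAm hBm
  -- the window integrals are at least `c₀² π2 / 16`
  have hWf : c₀ ^ 2 * π2 / 16 ≤ ∫ s in Set.Icc u v, P.real {ω | s < f ω} := by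
    have h := mul_sub_le_setIntegral_levelSet P f huv hfatf
    have : c₀ / 2 * (v - u) = c₀ ^ 2 * π2 / 16 := by rw [hu, hv]; ring
    linarith
  have hWg : c₀ ^ 2 * π2 / 16 ≤ ∫ t in Set.Icc u v, P.real {ω | t < g ω} := by
    have h := mul_sub_le_setIntegral_levelSet P g huv hfatg
    have : c₀ / 2 * (v - u) = c₀ ^ 2 * π2 / 16 := by rw [hu, hv]; ring
    linarith
  -- put everything together
  have hWpos : 0 ≤ c₀ ^ 2 * π2 / 16 := by positivity
  have hprod : (c₀ ^ 2 * π2 / 16) * (c₀ ^ 2 * π2 / 16) ≤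
      (∫ s in Set.Icc u v, P.real {ω | s < f ω}) * (∫ t in Set.Icc u v, P.real {ω | t < g ω}) :=
    mul_le_mul hWf hWg hWpos (hWpos.trans hWf)
  have hcov : δ' * ((c₀ ^ 2 * π2 / 16) * (c₀ ^ 2 * π2 / 16)) ≤
      P.real (A ∩ B) - tau 3 (criticalProbI 3) 0 ![(r : ℤ), (r : ℤ), 0] *
        tau 3 (criticalProbI 3) ![(r : ℤ), 0, (r : ℤ)] ![0, (r : ℤ), (r : ℤ)] := by
    rw [hτA, hτB]
    calc δ' * ((c₀ ^ 2 * π2 / 16) * (c₀ ^ 2 * π2 / 16))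
        ≤ δ' * ((∫ s in Set.Icc u v, P.real {ω | s < f ω}) *
            (∫ t in Set.Icc u v, P.real {ω | t < g ω})) :=
          mul_le_mul_of_nonneg_left hprod hδ'.le
      _ ≤ ∫ ω, f ω * g ω ∂P - (∫ ω, f ω ∂P) * (∫ ω, g ω ∂P) := hslice
      _ ≤ P.real (A ∩ B) - (∫ ω, f ω ∂P) * (∫ ω, g ω ∂P) := by linarith [hcond]
  -- `π2 ≥ τ_A`, `π2 ≥ τ_B`
  have hττ : tau 3 (criticalProbI 3) 0 ![(r : ℤ), (r : ℤ), 0] *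
      tau 3 (criticalProbI 3) ![(r : ℤ), 0, (r : ℤ)] ![0, (r : ℤ), (r : ℤ)] ≤ π2 * π2 :=
    mul_le_mul hτAle hτBle hτBpos.le hπ2pos.le
  have hfinal : δ' * c₀ ^ 4 / 256 * (tau 3 (criticalProbI 3) 0 ![(r : ℤ), (r : ℤ), 0] *
      tau 3 (criticalProbI 3) ![(r : ℤ), 0, (r : ℤ)] ![0, (r : ℤ), (r : ℤ)]) ≤
      δ' * ((c₀ ^ 2 * π2 / 16) * (c₀ ^ 2 * π2 / 16)) := by
    have : δ' * ((c₀ ^ 2 * π2 / 16) * (c₀ ^ 2 * π2 / 16)) = δ' * c₀ ^ 4 / 256 * (π2 * π2) := by ring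
    rw [this]
    exact mul_le_mul_of_nonneg_left hττ (by positivity)
  show (1 + δ' * c₀ ^ 4 / 256) * tau 3 (criticalProbI 3) 0 ![(r : ℤ), (r : ℤ), 0] *
      tau 3 (criticalProbI 3) ![(r : ℤ), 0, (r : ℤ)] ![0, (r : ℤ), (r : ℤ)] ≤ P.real (A ∩ B)
  nlinarith [hcov, hfinal]

end Summit.CriticalPhenomena.PercolationContinuityZ3.Theorems.TetrahedronHarrisGap

end
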